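import Mathlib
import Summits.ResolutionOfSingularities.ResolutionOfSingularities.Theorems.WeightedInvariantLocalWeightedDropPolyDescentNewtonTwo

/-!
# `WeightedInvariant.LocalWeightedDrop`, stub S3ρ: the monic polyhedron descent — CONSEQUENCES OF MINIMALITY of the well-prepared polygon: WP-uniqueness of `(α,β)`, `(ε,ζ)`; permissibility passes to the prepared re-centring (piece ρ-T, part 1)

Crux item stmt-ResolutionOfSingularities-8899 `LocalWeightedDrop` (route `ResolutionOfSingularities/WeightedInvariant`), registered skeleton v30
(09f812eb3be8b7d8), stub S3ρ `stub_wildMonicSurfaceReductionWon`.  [OURS · L1 W4.3, chain w43, lead prover (gen 3); a LINE UNDER THE STUB: the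
monic polyhedron descent (second key to S3ρ, memo `L/res-L1-w43-lead-1/g3/S3RHO-CJS-MEMO.md`, line file `poly_descent_line_v1.lean` evidence on
stmt-8899), MODEL Cossart–Jannsen–Saito LNM 2270 Ch. 8/11–13 for `J = (y^d + Σ_{j<d} A_j y^j)`, `e = 2`, `k = k̄`; nothing here is a statement of
any manuscript.]

All statements take Hironaka's MINIMALITY as a HYPOTHESIS `hmin` (the line's sub-stub `stub_polyMinimality`: re-centring a well-prepared position
never lowers a positive weight's minimum on the scaled Newton set), so they are usable before (ρ-M) lands.
* `shift_shift`, `shift_zero'`, `shift_shift_neg` — Taylor shifts compose (`Polynomial.taylor_taylor` through stub-7's `WildMonic.taylor_monicPoly`);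
* `alphaL_shift_le`, `betaL_shift_le`, `epsL_shift_le`, `zetaL_shift_le` — a re-centring of a WP position has `α′ ≤ α` (then `β′ ≤ β` on equal columns),
  `ε′ ≤ ε` (then `ζ′ ≤ ζ`) — weights `(M,1)` / `(1,M)`;
* `invariants_eq_of_wellPrepared` — TWO WELL-PREPARED positions differing by a re-centring have the same `α, β, ε, ζ` (degree-2 instance
  `MonicDescent.…WPUnique`);
* `isPermissibleTwoT/OneT_of_wellPrepared_shift` — if SOME re-centring of `S` is permissible for `V(y,u₂)` (resp. `V(y,u₁)`) then so is every well-prepared one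
  (degree-2 instance `MonicDescent.isPermissibleTwo_prep_shear`).
-/

set_option linter.dupNamespace false -- mandated namespace of this single-conjunct summit

noncomputable section

namespace Summit.ResolutionOfSingularities.ResolutionOfSingularities.Theorems

namespace PolyDescent

open MvPowerSeries MonicDescent WildMonic Literature.RingTheory.TwoVariableSeries

variable {k : Type} [Field k]

/-! ## Taylor shifts compose -/

/-- Re-centrings compose additively: `shift (shift A ψ) ψ′ = shift A (ψ′ + ψ)`. -/
theorem shift_shift {R : Type*} [CommRing R] [Nontrivial R] (d : ℕ) (A : Fin d → R) (ψ ψ' : R) :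
    shift d (shift d A ψ) ψ' = shift d A (ψ' + ψ) := by
  funext j
  show (Polynomial.taylor ψ' (monicPoly d (shift d A ψ))).coeff (j : ℕ) = (Polynomial.taylor (ψ' + ψ) (monicPoly d A)).coeff (j : ℕ)
  rw [← taylor_monicPoly, Polynomial.taylor_taylor]

/-- The trivial re-centring. -/
theorem shift_zero' {R : Type*} [CommRing R] [Nontrivial R] (d : ℕ) (A : Fin d → R) : shift d A 0 = A := by
  funext j
  unfold shift
  rw [Polynomial.taylor_zero, coeff_monicPoly_of_lt]

/-- Undoing a re-centring: `shift (shift A ψ) (−ψ) = A`. -/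
theorem shift_shift_neg {R : Type*} [CommRing R] [Nontrivial R] (d : ℕ) (A : Fin d → R) (ψ : R) : shift d (shift d A ψ) (-ψ) = A := by
  rw [shift_shift, neg_add_cancel, shift_zero']

/-! ## Weights on `ℕ²` -/

/-- The weight `(a, b)` of a point of `ℕ²`. -/
theorem weight_fin_two_eq (a b : ℕ) (P : Fin 2 →₀ ℕ) :
    Finsupp.weight (fun i : Fin 2 => if i = 0 then a else b) P = a * P 0 + b * P 1 := by
  rw [Finsupp.weight_apply, Finsupp.sum_fintype _ _ (by simp)]
  simp [Fin.sum_univ_two]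
  ring

/-! ## Consequences of MINIMALITY: a well-prepared re-centring never lowers `α`, then `β`; nor `ε`, then `ζ` -/

section Compare

variable {d : ℕ}
  (hmin : ∀ (B : Fin d → MvPowerSeries (Fin 2) k) (ψ : MvPowerSeries (Fin 2) k), WellPrepared d B → IsPosT d B → constantCoeff ψ = 0 →
    ∀ w : Fin 2 → ℕ, (∀ i, 0 < w i) → ∀ P ∈ newtonSet B, ∃ Q ∈ newtonSet (shift d B ψ), Finsupp.weight w Q ≤ Finsupp.weight w P)
include hmin

/-- If `B` is a well-prepared position then the support of every re-centring `shift B ψ` reaches at least as far LEFT as `α(B)` … precisely: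
`α(shift B ψ) ≤ α(B)`. -/
theorem alphaL_shift_le {B : Fin d → MvPowerSeries (Fin 2) k} {ψ : MvPowerSeries (Fin 2) k} (hWP : WellPrepared d B) (hpos : IsPosT d B)
    (hψ : constantCoeff ψ = 0) (hne : (newtonSet B).Nonempty) :
    alphaL (newtonSet (shift d B ψ)) ≤ alphaL (newtonSet B) := by
  obtain ⟨P, hP, hP0⟩ := exists_eq_alphaL hne
  obtain ⟨Q, hQ, hQw⟩ := hmin B ψ hWP hpos hψ (fun i => if i = 0 then P 1 + 1 else 1)
    (fun i => by fin_cases i <;> simp) P hP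
  rw [weight_fin_two_eq, weight_fin_two_eq] at hQw
  have hQ0 := alphaL_le hQ
  rw [← hP0]
  by_contra hlt
  push Not at hlt
  have : P 0 + 1 ≤ Q 0 := by omega
  nlinarith

/-- … and on the column `α(B)` no point of `shift B ψ` lies below `β(B)`: if `α(shift B ψ) = α(B)` then `β(shift B ψ) ≤ β(B)`. -/
theorem betaL_shift_le {B : Fin d → MvPowerSeries (Fin 2) k} {ψ : MvPowerSeries (Fin 2) k} (hWP : WellPrepared d B) (hpos : IsPosT d B)
    (hψ : constantCoeff ψ = 0) (hne : (newtonSet B).Nonempty) (hα : alphaL (newtonSet (shift d B ψ)) = alphaL (newtonSet B)) :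
    betaL (newtonSet (shift d B ψ)) ≤ betaL (newtonSet B) := by
  obtain ⟨P, hP, hP0, hP1⟩ := exists_eq_betaL hne
  obtain ⟨Q, hQ, hQw⟩ := hmin B ψ hWP hpos hψ (fun i => if i = 0 then P 1 + 1 else 1)
    (fun i => by fin_cases i <;> simp) P hP
  rw [weight_fin_two_eq, weight_fin_two_eq] at hQw
  have hQ0 := alphaL_le hQ
  rw [hα, ← hP0] at hQ0
  rcases Nat.eq_or_lt_of_le hQ0 with heq | hlt
  · have hQ1 := betaL_le hQ (by rw [← heq, hα, hP0])
    rw [← hP1]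
    have : Q 1 ≤ P 1 := by rw [← heq] at hQw; omega
    exact le_trans hQ1 this
  · exfalso
    have : P 0 + 1 ≤ Q 0 := by omega
    nlinarith

/-- The ROW version: `ε(shift B ψ) ≤ ε(B)`. -/
theorem epsL_shift_le {B : Fin d → MvPowerSeries (Fin 2) k} {ψ : MvPowerSeries (Fin 2) k} (hWP : WellPrepared d B) (hpos : IsPosT d B)
    (hψ : constantCoeff ψ = 0) (hne : (newtonSet B).Nonempty) :
    epsL (newtonSet (shift d B ψ)) ≤ epsL (newtonSet B) := by
  obtain ⟨P, hP, hP1⟩ := exists_eq_epsL hne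
  obtain ⟨Q, hQ, hQw⟩ := hmin B ψ hWP hpos hψ (fun i => if i = 0 then 1 else P 0 + 1)
    (fun i => by fin_cases i <;> simp) P hP
  rw [weight_fin_two_eq, weight_fin_two_eq] at hQw
  have hQ1 := epsL_le hQ
  rw [← hP1]
  by_contra hlt
  push Not at hlt
  have : P 1 + 1 ≤ Q 1 := by omega
  nlinarith

/-- … and `ζ(shift B ψ) ≤ ζ(B)` when the lowest rows agree. -/
theorem zetaL_shift_le {B : Fin d → MvPowerSeries (Fin 2) k} {ψ : MvPowerSeries (Fin 2) k} (hWP : WellPrepared d B) (hpos : IsPosT d B)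
    (hψ : constantCoeff ψ = 0) (hne : (newtonSet B).Nonempty) (hε : epsL (newtonSet (shift d B ψ)) = epsL (newtonSet B)) :
    zetaL (newtonSet (shift d B ψ)) ≤ zetaL (newtonSet B) := by
  obtain ⟨P, hP, hP1, hP0⟩ := exists_eq_zetaL hne
  obtain ⟨Q, hQ, hQw⟩ := hmin B ψ hWP hpos hψ (fun i => if i = 0 then 1 else P 0 + 1)
    (fun i => by fin_cases i <;> simp) P hP
  rw [weight_fin_two_eq, weight_fin_two_eq] at hQw
  have hQ1 := epsL_le hQ
  rw [hε, ← hP1] at hQ1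
  rcases Nat.eq_or_lt_of_le hQ1 with heq | hlt
  · have hQ0 := zetaL_le hQ (by rw [← heq, hε, hP1])
    rw [← hP0]
    have : Q 0 ≤ P 0 := by rw [← heq] at hQw; omega
    exact le_trans hQ0 this
  · exfalso
    have : P 1 + 1 ≤ Q 1 := by omega
    nlinarith

/-- WP-UNIQUENESS OF `(α, β)` and `(ε, ζ)`: two WELL-PREPARED positions that differ by a re-centring have the same four invariants (both polygons are
the characteristic polygon).  Degree-2 instance: `MonicDescent.alphaL_betaL_eq_of_wellPrepared` / `epsL_zetaL_eq_of_wellPrepared` (…WPUnique). -/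
theorem invariants_eq_of_wellPrepared {B : Fin d → MvPowerSeries (Fin 2) k} {ψ : MvPowerSeries (Fin 2) k}
    (hWP : WellPrepared d B) (hpos : IsPosT d B) (hψ : constantCoeff ψ = 0) (hne : (newtonSet B).Nonempty)
    (hWP' : WellPrepared d (shift d B ψ)) (hpos' : IsPosT d (shift d B ψ)) (hne' : (newtonSet (shift d B ψ)).Nonempty) :
    alphaL (newtonSet (shift d B ψ)) = alphaL (newtonSet B) ∧ betaL (newtonSet (shift d B ψ)) = betaL (newtonSet B) ∧
    epsL (newtonSet (shift d B ψ)) = epsL (newtonSet B) ∧ zetaL (newtonSet (shift d B ψ)) = zetaL (newtonSet B) := by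
  have hψ' : constantCoeff (-ψ) = 0 := by rw [map_neg, hψ, neg_zero]
  have hback : shift d (shift d B ψ) (-ψ) = B := shift_shift_neg d B ψ
  have hα : alphaL (newtonSet (shift d B ψ)) = alphaL (newtonSet B) := by
    apply le_antisymm (alphaL_shift_le hmin hWP hpos hψ hne)
    have h := alphaL_shift_le hmin hWP' hpos' hψ' hne'
    rwa [hback] at h
  have hε : epsL (newtonSet (shift d B ψ)) = epsL (newtonSet B) := by
    apply le_antisymm (epsL_shift_le hmin hWP hpos hψ hne)
    have h := epsL_shift_le hmin hWP' hpos' hψ' hne'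
    rwa [hback] at h
  refine ⟨hα, ?_, hε, ?_⟩
  · apply le_antisymm (betaL_shift_le hmin hWP hpos hψ hne hα)
    have h := betaL_shift_le hmin hWP' hpos' hψ' hne' (by rw [hback]; exact hα.symm)
    rwa [hback] at h
  · apply le_antisymm (zetaL_shift_le hmin hWP hpos hψ hne hε)
    have h := zetaL_shift_le hmin hWP' hpos' hψ' hne' (by rw [hback]; exact hε.symm)
    rwa [hback] at h

/-- PERMISSIBILITY OF `V(y,u₂)` PASSES TO THE WELL-PREPARED RE-CENTRING: if SOME re-centring `shift S ψ′` of `S` has `u₂^{d−j} ∣` every slot and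
`B = shift S ψ` is a well-prepared position, then so does `B` (its polygon is the smallest one).  Degree-2 instance:
`MonicDescent.isPermissibleTwo_prep_shear`. -/
theorem isPermissibleTwoT_of_wellPrepared_shift {S : Fin d → MvPowerSeries (Fin 2) k} {ψ ψ' : MvPowerSeries (Fin 2) k}
    (hperm : IsPermissibleTwoT d (shift d S ψ')) (hψ : constantCoeff ψ = 0) (hψ' : constantCoeff ψ' = 0)
    (hWP : WellPrepared d (shift d S ψ)) (hpos : IsPosT d (shift d S ψ)) :
    IsPermissibleTwoT d (shift d S ψ) := by
  intro j e he
  set B := shift d S ψ with hB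
  have hrel : shift d B (ψ' - ψ) = shift d S ψ' := by rw [hB, shift_shift, sub_add_cancel]
  have hP : slotWeight d j • e ∈ newtonSet B := ⟨j, e, he, rfl⟩
  set M : ℕ := slotWeight d j * e 0 + 1 with hM
  obtain ⟨Q, hQ, hQw⟩ := hmin B (ψ' - ψ) hWP hpos (by rw [map_sub, hψ, hψ', sub_zero])
    (fun i => if i = 0 then 1 else M) (fun i => by fin_cases i <;> simp [hM]) _ hP
  rw [weight_fin_two_eq, weight_fin_two_eq] at hQw
  simp only [Finsupp.smul_apply, smul_eq_mul, one_mul] at hQw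
  rw [hrel] at hQ
  obtain ⟨j', e', he', rfl⟩ := hQ
  have hQ1 : d.factorial ≤ slotWeight d j' * e' 1 := by
    rw [← slotWeight_mul_sub j']; exact Nat.mul_le_mul_left _ (hperm j' e' he')
  simp only [Finsupp.smul_apply, smul_eq_mul] at hQw
  have hws := slotWeight_mul_sub j
  have hwpos := slotWeight_pos j
  have h2 : M * d.factorial < M * (slotWeight d j * e 1 + 1) := by
    have hc : slotWeight d j * e 0 < M := by rw [hM]; exact Nat.lt_succ_self _
    calc M * d.factorial ≤ M * (slotWeight d j' * e' 1) := Nat.mul_le_mul_left _ hQ1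
      _ ≤ slotWeight d j * e 0 + M * (slotWeight d j * e 1) := by linarith [Nat.zero_le (slotWeight d j' * e' 0)]
      _ < M + M * (slotWeight d j * e 1) := by linarith
      _ = M * (slotWeight d j * e 1 + 1) := by ring
  have h3 : d.factorial < slotWeight d j * e 1 + 1 := Nat.lt_of_mul_lt_mul_left h2
  -- hence `d! ≤ w_j e₁`, i.e. `d − j ≤ e₁`
  by_contra hlt
  push Not at hlt
  have h1 : slotWeight d j * e 1 + slotWeight d j ≤ d.factorial := by
    rw [← hws, ← Nat.mul_succ]; exact Nat.mul_le_mul_left _ hlt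
  linarith

/-- Likewise for `V(y,u₁)`. -/
theorem isPermissibleOneT_of_wellPrepared_shift {S : Fin d → MvPowerSeries (Fin 2) k} {ψ ψ' : MvPowerSeries (Fin 2) k}
    (hperm : IsPermissibleOneT d (shift d S ψ')) (hψ : constantCoeff ψ = 0) (hψ' : constantCoeff ψ' = 0)
    (hWP : WellPrepared d (shift d S ψ)) (hpos : IsPosT d (shift d S ψ)) :
    IsPermissibleOneT d (shift d S ψ) := by
  intro j e he
  set B := shift d S ψ with hB
  have hrel : shift d B (ψ' - ψ) = shift d S ψ' := by rw [hB, shift_shift, sub_add_cancel]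
  have hP : slotWeight d j • e ∈ newtonSet B := ⟨j, e, he, rfl⟩
  set M : ℕ := slotWeight d j * e 1 + 1 with hM
  obtain ⟨Q, hQ, hQw⟩ := hmin B (ψ' - ψ) hWP hpos (by rw [map_sub, hψ, hψ', sub_zero])
    (fun i => if i = 0 then M else 1) (fun i => by fin_cases i <;> simp [hM]) _ hP
  rw [weight_fin_two_eq, weight_fin_two_eq] at hQw
  simp only [Finsupp.smul_apply, smul_eq_mul, one_mul] at hQw
  rw [hrel] at hQ
  obtain ⟨j', e', he', rfl⟩ := hQ
  have hQ0 : d.factorial ≤ slotWeight d j' * e' 0 := by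
    rw [← slotWeight_mul_sub j']; exact Nat.mul_le_mul_left _ (hperm j' e' he')
  simp only [Finsupp.smul_apply, smul_eq_mul] at hQw
  have hws := slotWeight_mul_sub j
  have hwpos := slotWeight_pos j
  have h2 : M * d.factorial < M * (slotWeight d j * e 0 + 1) := by
    have hc : slotWeight d j * e 1 < M := by rw [hM]; exact Nat.lt_succ_self _
    calc M * d.factorial ≤ M * (slotWeight d j' * e' 0) := Nat.mul_le_mul_left _ hQ0
      _ ≤ M * (slotWeight d j * e 0) + slotWeight d j * e 1 := by linarith [Nat.zero_le (slotWeight d j' * e' 1)]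
      _ < M * (slotWeight d j * e 0) + M := by linarith
      _ = M * (slotWeight d j * e 0 + 1) := by ring
  have h3 : d.factorial < slotWeight d j * e 0 + 1 := Nat.lt_of_mul_lt_mul_left h2
  by_contra hlt
  push Not at hlt
  have h1 : slotWeight d j * e 0 + slotWeight d j ≤ d.factorial := by
    rw [← hws, ← Nat.mul_succ]; exact Nat.mul_le_mul_left _ hlt
  linarith

end Compare

end PolyDescent

end Summit.ResolutionOfSingularities.ResolutionOfSingularities.Theorems

end
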